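import Mathlib.FieldTheory.IsAlgClosed.Classification
import Mathlib.FieldTheory.IntermediateField.Adjoin.Basic
import Mathlib.FieldTheory.Normal.Closure
import Mathlib.FieldTheory.Galois.Basic
import Mathlib.Analysis.Complex.Polynomial.Basic
import HarnessLib

/-!
# Extension of automorphisms of subfields to an algebraically closed field, and generation of
# `Aut(Ω/E)` by the groups `Aut(Ω/Eᵢ)` when `E = ⋂ Eᵢ` (the group theory behind Deligne 1971, Lemme 5.10.1)

Topic `FieldTheory/AlgClosed`, namespace `Literature.FieldTheory.AlgClosed`.  Everything here is
**proved** (no definitions of mathematical content, no named facts; Literature debt 0).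

For an algebraically closed field `Ω` (e.g. `Ω = ℂ`):

* `exists_ringEquiv_apply_eq_apply` — every automorphism `γ` of a field `F` embedded by `ι : F →+* Ω`
  extends to an automorphism `σ` of `Ω`: `σ (ι x) = ι (γ x)`.  Proof (Lang, *Algebra*, Ch. VIII §1 with
  Ch. V §2 Thm. 2.8): choose a transcendence basis `s` of `Ω` over `ι F`; `γ` acts on `ι F [s] ≅ (ι F)[Xₛ]`
  through the coefficients, and `Ω` is an algebraic closure of `ι F [s]`
  (`IsAlgClosed.isAlgClosure_of_transcendence_basis`), so the ring automorphism of `ι F [s]` extends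
  (`IsAlgClosure.equivOfEquiv`).  No countability / cardinality hypothesis is needed (compare the
  two-embedding statement `exists_ringEquiv_apply_eq` of `AutomorphismExtension.lean`, which needs
  equipotent transcendence bases).
* `exists_algEquiv_apply_eq_algEquiv` — the same over a base field `E ⊆ F ⊆ Ω`: every `γ : F ≃ₐ[E] F`
  is the restriction of some `σ : Ω ≃ₐ[E] Ω`; `restrictNormalHom_surjective_of_isAlgClosed` — for
  `E'/E` normal inside `Ω`, restriction `Aut(Ω/E) → Gal(E'/E)` is surjective.
* `iSup_fixingSubgroup_eq_top_of_iInf_eq_bot` — **generation**: if `Ω` has characteristic `0` and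
  `F₁, …, Fₙ` (`n ≥ 1`) are intermediate fields of `Ω/E`, finite over `E`, with `⋂ Fᵢ = E`, then
  `Aut(Ω/E)` is generated by the subgroups `Aut(Ω/Fᵢ)`: `⨆ᵢ Aut(Ω/Fᵢ) = ⊤`.  Proof (the word
  decomposition of Deligne, *Travaux de Shimura*, Lemme 5.10.1, «`Gal(F/E)` engendré par les
  `Gal(F/Eᵢ)`»): let `E'` be the normal closure of the compositum, finite Galois over `E`; by the Galois
  correspondence `Gal(E'/E) = ⨆ Gal(E'/Fᵢ)` (`⋂ Fᵢ = E`); write `σ|E' = γ₁ ⋯ γₘ` with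
  `γⱼ ∈ Gal(E'/F_{iⱼ})`, lift each `γⱼ` to `σⱼ ∈ Aut(Ω/E)` (surjectivity above) — it fixes `F_{iⱼ}` — and
  note that `(σ₁ ⋯ σₘ)⁻¹ σ` fixes `E'`, hence `F_{i₀}`.  Stated as an induction principle in
  `algEquiv_induction_of_iInf_eq_bot`, and in the currency of intermediate fields of `ℂ/ℚ`
  (`E = ⨅ Eᵢ`, `σ : ℂ ≃ₐ[E] ℂ`) in `Complex.algEquiv_induction_of_eq_iInf`.

Cell `hodgecm-mathlib` (D-0151), row I-6 `descentToIntersection_printed` (`_holds` programme, piece P0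
of A-p08's crew plan): the step «reciprocity over `E` for the descended model follows because `Aut(ℂ/E)`
is generated by the `Aut(ℂ/Eᵢ)`» of [Deligne1971TravauxShimura] Prop. 5.10 / Lemme 5.10.1.
HC_CM is proved only modulo the 7 printed citations until rung 0 closes; this file discharges none of them.

## References

* S. Lang, *Algebra*, rev. 3rd ed., GTM 211 (2002), Ch. VIII §1 (transcendence bases), Ch. V §2 Thm. 2.8
  (extension of isomorphisms to algebraic closures), Ch. VI §1 Thm. 1.1–1.2, Cor. 1.4 (Galois correspondence,
  `Gal(K/⋂Fᵢ)` is generated by the `Gal(K/Fᵢ)`). [Lang2002]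
* P. Deligne, *Travaux de Shimura*, Sém. Bourbaki 389, LNM 244 (1971), Lemme 5.10.1 (p. 158).
  [Deligne1971TravauxShimura]
-/

noncomputable section

namespace Literature.FieldTheory.AlgClosed

universe u v

/-! ### Extension of an automorphism of an embedded field -/

section General

variable {Ω : Type u} [Field Ω] {F : Type v} [Field F]

/-- An automorphism of a field induces an automorphism of its image under an embedding. [folklore] -/
private lemma exists_ringEquiv_range_apply_eq_apply (ι : F →+* Ω) (γ : F ≃+* F) :
    ∃ θ : ι.range ≃+* ι.range, ∀ x : F, θ (ι.rangeRestrict x) = ι.rangeRestrict (γ x) := by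
  let e₁ : F ≃+* ι.range :=
    RingEquiv.ofBijective ι.rangeRestrict ⟨ι.rangeRestrict.injective, ι.rangeRestrict_surjective⟩
  refine ⟨e₁.symm.trans (γ.trans e₁), fun x => ?_⟩
  rw [RingEquiv.trans_apply, RingEquiv.trans_apply]
  have : e₁.symm (ι.rangeRestrict x) = x := by
    rw [RingEquiv.symm_apply_eq]; rfl
  rw [this]; rfl

/-- **Every automorphism of an embedded field extends to the algebraically closed overfield.**
If `Ω` is algebraically closed, `ι : F →+* Ω` an embedding and `γ` an automorphism of `F`, there is an
automorphism `σ` of `Ω` with `σ (ι x) = ι (γ x)`: take a transcendence basis `s` of `Ω` over `ι F`; then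
`γ` acts on `ι F[s]` coefficientwise and `Ω` is an algebraic closure of `ι F[s]`, so this automorphism
extends to `Ω` (Mathlib `IsAlgClosure.equivOfEquiv`).  No cardinality hypothesis.
[cite: Lang2002, Ch. VIII §1 Thm. 1.1 and Ch. V §2 Thm. 2.8] -/
theorem exists_ringEquiv_apply_eq_apply [IsAlgClosed Ω] (ι : F →+* Ω) (γ : F ≃+* F) :
    ∃ σ : Ω ≃+* Ω, ∀ x : F, σ (ι x) = ι (γ x) := by
  obtain ⟨θ, hθ⟩ := exists_ringEquiv_range_apply_eq_apply ι γ
  obtain ⟨s, hs⟩ := exists_isTranscendenceBasis ι.range Ω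
  letI := IsAlgClosed.isAlgClosure_of_transcendence_basis _ hs
  set A₁ := Algebra.adjoin ι.range (Set.range ((↑) : s → Ω)) with hA₁
  let em : MvPolynomial s ι.range ≃+* MvPolynomial s ι.range := MvPolynomial.mapEquiv s θ
  let e' : A₁ ≃+* A₁ := (hs.1.aevalEquiv.symm.toRingEquiv.trans em).trans hs.1.aevalEquiv.toRingEquiv
  -- `e'` maps `ι x` to `ι (γ x)`
  have he' : ∀ x : F, e' (algebraMap ι.range A₁ (ι.rangeRestrict x)) =
      algebraMap ι.range A₁ (ι.rangeRestrict (γ x)) := by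
    intro x
    have h1 : hs.1.aevalEquiv.symm (algebraMap ι.range A₁ (ι.rangeRestrict x)) =
        MvPolynomial.C (ι.rangeRestrict x) := by
      rw [AlgEquiv.symm_apply_eq, ← MvPolynomial.algebraMap_eq, AlgEquiv.commutes]
    have h2 : em (MvPolynomial.C (ι.rangeRestrict x)) = MvPolynomial.C (ι.rangeRestrict (γ x)) := by
      change MvPolynomial.mapEquiv s θ (MvPolynomial.C _) = _
      rw [MvPolynomial.mapEquiv_apply, MvPolynomial.map_C]
      congr 1
      exact hθ x
    change hs.1.aevalEquiv (em (hs.1.aevalEquiv.symm _)) = _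
    rw [h1, h2, ← MvPolynomial.algebraMap_eq, AlgEquiv.commutes]
  refine ⟨IsAlgClosure.equivOfEquiv Ω Ω e', fun x => ?_⟩
  have h1 : ∀ y : F, (ι y : Ω) = algebraMap A₁ Ω (algebraMap ι.range A₁ (ι.rangeRestrict y)) := by
    intro y
    rw [← IsScalarTower.algebraMap_apply]; rfl
  rw [h1 x, h1 (γ x), IsAlgClosure.equivOfEquiv_algebraMap, he']

end General

/-! ### Over a base field: `E`-automorphisms of intermediate fields of `Ω/E` -/

section Base

variable {E : Type u} {Ω : Type v} [Field E] [Field Ω] [Algebra E Ω]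

/-- Membership in an infimum of intermediate fields. [folklore] -/
private lemma mem_iInf_intermediateField {ι : Sort*} {F : ι → IntermediateField E Ω} {x : Ω} :
    x ∈ ⨅ i, F i ↔ ∀ i, x ∈ F i := by
  rw [← SetLike.mem_coe, IntermediateField.coe_iInf, Set.mem_iInter]
  exact Iff.rfl

/-- An infimum of intermediate fields of `Ω/E` is `⊥` as soon as every common element comes from `E`.
[folklore] -/
private lemma iInf_eq_bot_of_forall_mem {ι : Sort*} (F : ι → IntermediateField E Ω)
    (h : ∀ x : Ω, (∀ i, x ∈ F i) → x ∈ Set.range (algebraMap E Ω)) : ⨅ i, F i = ⊥ :=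
  le_bot_iff.1 fun x hx => IntermediateField.mem_bot.2 (h x (mem_iInf_intermediateField.1 hx))

/-- **Extension over a base.**  For `Ω` algebraically closed and an intermediate field `F` of `Ω/E`,
every `E`-automorphism `γ` of `F` is the restriction of an `E`-automorphism `σ` of `Ω`
(`σ` fixes `E` because `γ` does). [cite: Lang2002, Ch. VIII §1 Thm. 1.1 and Ch. V §2 Thm. 2.8] -/
theorem exists_algEquiv_apply_eq_algEquiv [IsAlgClosed Ω] (F : IntermediateField E Ω)
    (γ : F ≃ₐ[E] F) : ∃ σ : Ω ≃ₐ[E] Ω, ∀ x : F, σ x = γ x := by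
  obtain ⟨σ, hσ⟩ := exists_ringEquiv_apply_eq_apply (algebraMap F Ω) γ.toRingEquiv
  have hcomm : ∀ a : E, σ (algebraMap E Ω a) = algebraMap E Ω a := by
    intro a
    have h := hσ (algebraMap E F a)
    rw [AlgEquiv.coe_ringEquiv, AlgEquiv.commutes, ← IsScalarTower.algebraMap_apply] at h
    exact h
  exact ⟨AlgEquiv.ofRingEquiv (f := σ) hcomm, fun x => hσ x⟩

/-- **Restriction `Aut(Ω/E) → Gal(E'/E)` is surjective** for `Ω` algebraically closed and `E' ⊆ Ω`
normal over `E` (every element of `Gal(E'/E)` extends to `Ω`). [cite: Lang2002, Ch. V §2 Thm. 2.8 with Ch. VIII §1] -/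
theorem restrictNormalHom_surjective_of_isAlgClosed [IsAlgClosed Ω] (E' : IntermediateField E Ω)
    [Normal E E'] :
    Function.Surjective (AlgEquiv.restrictNormalHom (F := E) (K₁ := Ω) E') := by
  intro g
  obtain ⟨σ, hσ⟩ := exists_algEquiv_apply_eq_algEquiv E' g
  refine ⟨σ, AlgEquiv.ext fun x => Subtype.ext ?_⟩
  rw [AlgEquiv.restrictNormalHom_apply]
  exact hσ x

/-- An `E`-automorphism of `Ω` whose restriction to a normal `E' ⊆ Ω` is `g` fixes pointwise every
subfield `F ⊆ E'` fixed pointwise by `g`. [folklore] -/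
private lemma mem_fixingSubgroup_of_restrictNormalHom_eq (E' : IntermediateField E Ω) [Normal E E']
    {F : IntermediateField E Ω} (hF : F ≤ E') {σ : Ω ≃ₐ[E] Ω} {g : E' ≃ₐ[E] E'}
    (hσ : AlgEquiv.restrictNormalHom E' σ = g)
    (hg : ∀ x : E', (x : Ω) ∈ F → g x = x) : σ ∈ F.fixingSubgroup := by
  rw [IntermediateField.mem_fixingSubgroup_iff]
  intro x hx
  have h1 := AlgEquiv.restrictNormalHom_apply E' σ ⟨x, hF hx⟩
  rw [hσ, hg ⟨x, hF hx⟩ hx] at h1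
  exact h1.symm

/-- **Generation of `Aut(Ω/E)` by the `Aut(Ω/Fᵢ)` when `⋂ Fᵢ = E`** (the group theory of Deligne 1971,
Lemme 5.10.1).  Let `Ω` be algebraically closed of characteristic `0`, `E ⊆ Ω` a subfield and
`F₁, …, Fₙ` (`n ≥ 1`) intermediate fields of `Ω/E`, each finite over `E`, with `⨅ Fᵢ = ⊥` (i.e.
`⋂ Fᵢ = E`).  Then the subgroups `Aut(Ω/Fᵢ) = Fᵢ.fixingSubgroup` generate `Aut(Ω/E) = Ω ≃ₐ[E] Ω`.
Proof: in the normal closure `E'` of the compositum (finite Galois over `E`) the Galois correspondence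
gives `Gal(E'/E) = ⨆ Gal(E'/Fᵢ)`; decompose `σ|E'` as a word in the `Gal(E'/Fᵢ)`, lift each letter to
`Aut(Ω/E)` (`restrictNormalHom_surjective_of_isAlgClosed`), and absorb the remainder, which fixes `E'`,
into `Aut(Ω/F_{i₀})`. [cite: Deligne1971TravauxShimura, Lemme 5.10.1 (p. 158)] [cite: Lang2002, Ch. VI §1 Cor. 1.4 and Thm. 1.2] -/
theorem iSup_fixingSubgroup_eq_top_of_iInf_eq_bot [IsAlgClosed Ω] [CharZero Ω] {ι : Type*} [Finite ι]
    [Nonempty ι] (F : ι → IntermediateField E Ω) [∀ i, FiniteDimensional E (F i)]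
    (hF : ⨅ i, F i = ⊥) :
    (⨆ i, (F i).fixingSubgroup : Subgroup (Ω ≃ₐ[E] Ω)) = ⊤ := by
  classical
  haveI : CharZero E := (algebraMap E Ω).charZero
  -- the normal closure `E'` of the compositum: finite Galois over `E`, containing every `F i`
  let M : IntermediateField E Ω := ⨆ i, F i
  haveI : FiniteDimensional E M := IntermediateField.finiteDimensional_iSup_of_finite
  let E' : IntermediateField E Ω := IntermediateField.normalClosure E M Ω
  haveI hE'fd : FiniteDimensional E E' := normalClosure.is_finiteDimensional E M Ω
  have hnc : IsNormalClosure E M E' :=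
    Algebra.IsAlgebraic.isNormalClosure_normalClosure (fun x => IsAlgClosed.splits _)
  haveI : Normal E E' := hnc.normal
  haveI : IsGalois E E' := IsGalois.mk
  have hFE' : ∀ i, F i ≤ E' := fun i => (le_iSup F i).trans (IntermediateField.le_normalClosure M)
  -- the `F i` as intermediate fields of `E'/E`
  let K : ι → IntermediateField E E' := fun i => IntermediateField.restrict (hFE' i)
  have hmemK : ∀ i (x : E'), x ∈ K i ↔ (x : Ω) ∈ F i := fun i x => IntermediateField.mem_restrict _ x
  have hK : ⨅ i, K i = ⊥ := by
    refine iInf_eq_bot_of_forall_mem K fun x hx => ?_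
    have hxbot : (x : Ω) ∈ (⊥ : IntermediateField E Ω) := by
      rw [← hF, mem_iInf_intermediateField]
      exact fun i => (hmemK i x).1 (hx i)
    obtain ⟨a, ha⟩ := IntermediateField.mem_bot.1 hxbot
    exact ⟨a, Subtype.ext (by rw [IntermediateField.coe_algebraMap_apply, ha])⟩
  -- Galois correspondence inside `E'`: the `Gal(E'/K i)` generate `Gal(E'/E)`
  have hsup : (⨆ i, (K i).fixingSubgroup : Subgroup (E' ≃ₐ[E] E')) = ⊤ := by
    have hle : IntermediateField.fixedField (⨆ i, (K i).fixingSubgroup) ≤ (⊥ : IntermediateField E E') := by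
      rw [← hK]
      exact le_iInf fun i => (IntermediateField.fixedField_antitone (le_iSup _ i)).trans
        (IsGalois.fixedField_fixingSubgroup (K i)).le
    have h := IsGalois.fixedField_eq_iff_fixingSubgroup_eq.1 (le_bot_iff.1 hle)
    rw [IntermediateField.fixingSubgroup_bot] at h
    exact h.symm
  -- the word decomposition, as an induction over `⨆ Gal(E'/K i)`
  have key : ∀ g : E' ≃ₐ[E] E', g ∈ (⨆ i, (K i).fixingSubgroup : Subgroup (E' ≃ₐ[E] E')) →
      ∀ σ : Ω ≃ₐ[E] Ω, AlgEquiv.restrictNormalHom E' σ = g →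
        σ ∈ (⨆ i, (F i).fixingSubgroup : Subgroup (Ω ≃ₐ[E] Ω)) := by
    intro g hg
    refine Subgroup.iSup_induction (C := fun g => ∀ σ : Ω ≃ₐ[E] Ω,
      AlgEquiv.restrictNormalHom E' σ = g → σ ∈ (⨆ i, (F i).fixingSubgroup : Subgroup (Ω ≃ₐ[E] Ω)))
      _ hg (fun i g hgi σ hσ => ?_) (fun σ hσ => ?_) (fun x y hx hy σ hσ => ?_)
    · -- a letter `g ∈ Gal(E'/K i)`: `σ` fixes `F i`
      refine Subgroup.mem_iSup_of_mem i (mem_fixingSubgroup_of_restrictNormalHom_eq E' (hFE' i) hσ ?_)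
      intro x hx
      exact (IntermediateField.mem_fixingSubgroup_iff _ _).1 hgi x ((hmemK i x).2 hx)
    · -- the empty word: `σ` fixes `E'`, hence `F i₀`
      obtain ⟨i⟩ := ‹Nonempty ι›
      refine Subgroup.mem_iSup_of_mem i (mem_fixingSubgroup_of_restrictNormalHom_eq E' (hFE' i) hσ ?_)
      intro x _
      rfl
    · -- concatenation: lift the first letter to `Ω` and induct
      obtain ⟨σx, hσx⟩ := restrictNormalHom_surjective_of_isAlgClosed E' x
      have hrest : AlgEquiv.restrictNormalHom E' (σx⁻¹ * σ) = y := by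
        rw [map_mul, map_inv, hσx, hσ, inv_mul_cancel_left]
      have h := Subgroup.mul_mem _ (hx σx hσx) (hy _ hrest)
      rwa [mul_inv_cancel_left] at h
  rw [eq_top_iff]
  intro σ _
  exact key _ (hsup ▸ Subgroup.mem_top _) σ rfl

/-- **Induction principle** form of `iSup_fixingSubgroup_eq_top_of_iInf_eq_bot`: to prove a property of
every `E`-automorphism of `Ω` that is stable under composition, it suffices to prove it for the
automorphisms fixing one of the `Fᵢ` pointwise (`⋂ Fᵢ = E`, each `Fᵢ` finite over `E`, `n ≥ 1`).
[cite: Deligne1971TravauxShimura, Lemme 5.10.1 (p. 158)] -/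
theorem algEquiv_induction_of_iInf_eq_bot [IsAlgClosed Ω] [CharZero Ω] {ι : Type*} [Finite ι]
    [Nonempty ι] (F : ι → IntermediateField E Ω) [∀ i, FiniteDimensional E (F i)]
    (hF : ⨅ i, F i = ⊥) {p : (Ω ≃ₐ[E] Ω) → Prop}
    (mem : ∀ (i) (σ : Ω ≃ₐ[E] Ω), (∀ x : Ω, x ∈ F i → σ x = x) → p σ)
    (mul : ∀ σ τ : Ω ≃ₐ[E] Ω, p σ → p τ → p (σ * τ)) (σ : Ω ≃ₐ[E] Ω) : p σ := by
  have hσ : σ ∈ (⨆ i, (F i).fixingSubgroup : Subgroup (Ω ≃ₐ[E] Ω)) := by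
    rw [iSup_fixingSubgroup_eq_top_of_iInf_eq_bot F hF]; exact Subgroup.mem_top σ
  obtain ⟨i⟩ := ‹Nonempty ι›
  exact Subgroup.iSup_induction (C := p) _ hσ
    (fun i τ hτ => mem i τ ((IntermediateField.mem_fixingSubgroup_iff _ _).1 hτ))
    (mem i 1 fun x _ => rfl) mul

end Base

/-! ### The currency of row I-6: number fields inside `ℂ`, `E = ⨅ Eᵢ`, `σ : ℂ ≃ₐ[E] ℂ` -/

section Complex

open IntermediateField

/-- For intermediate fields `E ≤ E₁` of `ℂ/ℚ` with `E₁` finite over `ℚ`, `E₁` is finite over `E`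
(as the intermediate field `extendScalars` of `ℂ/E`; the tower `ℚ ⊆ E ⊆ E₁`).
[cite: Lang2002, Ch. V §1 Prop. 1.2 (finiteness in towers)] -/
lemma Complex.finiteDimensional_extendScalars {E E₁ : IntermediateField ℚ ℂ} (h : E ≤ E₁)
    [FiniteDimensional ℚ E₁] : FiniteDimensional E (extendScalars h) := by
  let f : extendScalars h →ₗ[ℚ] E₁ :=
    { toFun := fun x => ⟨x.1, (mem_extendScalars h).1 x.2⟩
      map_add' := fun _ _ => rfl
      map_smul' := fun _ _ => rfl }
  haveI : FiniteDimensional ℚ (extendScalars h) :=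
    FiniteDimensional.of_injective f fun x y hxy => Subtype.ext (congrArg Subtype.val hxy)
  exact Module.Finite.of_restrictScalars_finite ℚ E (extendScalars h)

/-- **Every `E`-automorphism of a number field `E₁ ⊆ ℂ` extends to `Aut(ℂ/E)`**: for intermediate fields
`E ≤ E₁` of `ℂ/ℚ` and `γ : E₁ ≃ₐ[E] E₁` there is `σ : ℂ ≃ₐ[E] ℂ` with `σ x = γ x` on `E₁`.
[cite: Lang2002, Ch. V §2 Thm. 2.8 with Ch. VIII §1 Thm. 1.1] -/
theorem Complex.exists_algEquiv_apply_eq_extendScalars {E E₁ : IntermediateField ℚ ℂ} (h : E ≤ E₁)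
    (γ : extendScalars h ≃ₐ[E] extendScalars h) :
    ∃ σ : ℂ ≃ₐ[E] ℂ, ∀ x : extendScalars h, σ x = γ x :=
  Literature.FieldTheory.AlgClosed.exists_algEquiv_apply_eq_algEquiv (extendScalars h) γ

/-- **`Aut(ℂ/E)` is generated by the `Aut(ℂ/Eᵢ)` for `E = ⨅ Eᵢ`** (finite nonempty family of number
fields `Eᵢ ⊆ ℂ`): with `Eᵢ` read as intermediate fields of `ℂ/E`, `⨆ᵢ Aut(ℂ/Eᵢ) = ⊤` in `ℂ ≃ₐ[E] ℂ`.
[cite: Deligne1971TravauxShimura, Lemme 5.10.1 (p. 158)] [cite: Lang2002, Ch. VI §1 Cor. 1.4] -/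
theorem Complex.iSup_fixingSubgroup_extendScalars_eq_top {ι : Type*} [Finite ι] [Nonempty ι]
    (Ei : ι → IntermediateField ℚ ℂ) [∀ i, FiniteDimensional ℚ (Ei i)] (E : IntermediateField ℚ ℂ)
    (hE : E = ⨅ i, Ei i) :
    (⨆ i, (extendScalars (show E ≤ Ei i from hE ▸ iInf_le Ei i)).fixingSubgroup :
      Subgroup (ℂ ≃ₐ[E] ℂ)) = ⊤ := by
  haveI : ∀ i, FiniteDimensional E (extendScalars (show E ≤ Ei i from hE ▸ iInf_le Ei i)) :=
    fun i => Complex.finiteDimensional_extendScalars _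
  refine iSup_fixingSubgroup_eq_top_of_iInf_eq_bot _ (iInf_eq_bot_of_forall_mem _ fun x hx => ?_)
  have hxE : x ∈ E := by
    rw [hE, mem_iInf_intermediateField]
    exact fun i => (mem_extendScalars _).1 (hx i)
  exact ⟨⟨x, hxE⟩, rfl⟩

/-- **Induction principle for `Aut(ℂ/E)`, `E = ⨅ Eᵢ`** (the form consumed by the descent of Shimura
reciprocity to the intersection, Deligne 1971 Prop. 5.10): a property of `E`-automorphisms of `ℂ`
stable under composition and holding for every automorphism fixing some `Eᵢ` pointwise holds for all of
`Aut(ℂ/E)`. [cite: Deligne1971TravauxShimura, Prop. 5.10 and Lemme 5.10.1 (pp. 157–158)] -/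
theorem Complex.algEquiv_induction_of_eq_iInf {ι : Type*} [Finite ι] [Nonempty ι]
    (Ei : ι → IntermediateField ℚ ℂ) [∀ i, FiniteDimensional ℚ (Ei i)] (E : IntermediateField ℚ ℂ)
    (hE : E = ⨅ i, Ei i) {p : (ℂ ≃ₐ[E] ℂ) → Prop}
    (mem : ∀ (i) (σ : ℂ ≃ₐ[E] ℂ), (∀ x : ℂ, x ∈ Ei i → σ x = x) → p σ)
    (mul : ∀ σ τ : ℂ ≃ₐ[E] ℂ, p σ → p τ → p (σ * τ)) (σ : ℂ ≃ₐ[E] ℂ) : p σ := by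
  have hσ : σ ∈ (⨆ i, (extendScalars (show E ≤ Ei i from hE ▸ iInf_le Ei i)).fixingSubgroup :
      Subgroup (ℂ ≃ₐ[E] ℂ)) := by
    rw [Complex.iSup_fixingSubgroup_extendScalars_eq_top Ei E hE]; exact Subgroup.mem_top σ
  obtain ⟨i⟩ := ‹Nonempty ι›
  exact Subgroup.iSup_induction (C := p) _ hσ
    (fun i τ hτ => mem i τ fun x hx =>
      (mem_fixingSubgroup_iff _ _).1 hτ x ((mem_extendScalars _).2 hx))
    (mem i 1 fun x _ => rfl) mul

/-- **P0 in the currency of the I-6 crew (plain automorphisms of `ℂ` with pointwise fixing).**  For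
intermediate fields `E ≤ E'` of `ℂ/ℚ` and `γ ∈ Gal(E'/E)` — `E'` read as the intermediate field
`extendScalars h` of `ℂ/E`, `γ : ↥(extendScalars h) ≃ₐ[↥E] ↥(extendScalars h)` — there is a ring
automorphism `σ : ℂ ≃+* ℂ` fixing `E` pointwise with `σ x = γ x` on `E'`.
[cite: Lang2002, Ch. V §2 Thm. 2.8 with Ch. VIII §1 Thm. 1.1] -/
theorem Complex.exists_ringEquiv_apply_eq_extendScalars {E E₁ : IntermediateField ℚ ℂ} (h : E ≤ E₁)
    (γ : extendScalars h ≃ₐ[E] extendScalars h) :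
    ∃ σ : ℂ ≃+* ℂ, (∀ x : E, σ x = x) ∧ ∀ x : extendScalars h, σ x = γ x := by
  obtain ⟨σ, hσ⟩ := Complex.exists_algEquiv_apply_eq_extendScalars h γ
  exact ⟨σ.toRingEquiv, fun x => σ.commutes x, hσ⟩

/-- **Generation, plain-automorphism form**: for `E = ⨅ Eᵢ` (finite nonempty family of number fields
`Eᵢ ⊆ ℂ`), a property of ring automorphisms of `ℂ` that is stable under composition and holds for every
automorphism fixing some `Eᵢ` pointwise holds for every automorphism fixing `E` pointwise.
[cite: Deligne1971TravauxShimura, Prop. 5.10 and Lemme 5.10.1 (pp. 157–158)] -/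
theorem Complex.ringEquiv_induction_of_eq_iInf {ι : Type*} [Finite ι] [Nonempty ι]
    (Ei : ι → IntermediateField ℚ ℂ) [∀ i, FiniteDimensional ℚ (Ei i)] (E : IntermediateField ℚ ℂ)
    (hE : E = ⨅ i, Ei i) {p : (ℂ ≃+* ℂ) → Prop}
    (mem : ∀ (i) (σ : ℂ ≃+* ℂ), (∀ x : ℂ, x ∈ Ei i → σ x = x) → p σ)
    (mul : ∀ σ τ : ℂ ≃+* ℂ, p σ → p τ → p (σ * τ)) (σ : ℂ ≃+* ℂ) (hσ : ∀ x : E, σ x = x) :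
    p σ := by
  have h := Complex.algEquiv_induction_of_eq_iInf Ei E hE (p := fun ρ : ℂ ≃ₐ[E] ℂ => p ρ.toRingEquiv)
    (fun i ρ hρ => mem i ρ.toRingEquiv hρ) (fun ρ ρ' hρ hρ' => mul ρ.toRingEquiv ρ'.toRingEquiv hρ hρ')
    (AlgEquiv.ofRingEquiv (f := σ) fun x => hσ x)
  exact h

end Complex

end Literature.FieldTheory.AlgClosed

end
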